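import Summits.SmoothPoincare4.SmoothPoincare4.Theses.WeakReductionDescent
import Summits.SmoothPoincare4.SmoothPoincare4.Theorems.WeakReductionDescentWeakReductionReducesStubLoopDichotomyFromFiveAux1

/-!
# Crux `WeakReductionReduces` (stmt-SmoothPoincare4-17908), line `loop_dichotomy`, stub D₄
# (`stub_loopDichotomyFour`) — the stub is cut to its IRREDUCIBLE FIXED-LABEL CORE (proved glue)

Stub D₄ of skeleton v3 (lead seat c1, `Cruxes/WeakReductionReduces/Lines/loop_dichotomy.lean`, sha
66732100…; "Aranda–Zupan at genus 4 for homotopy spheres"): for a smooth homotopy 4-sphere `M` (bare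
binders + `e : M ≃ₕ S⁴`) and a weakly reducible `(4; k)`-GK-trisection `T` with `k₀ + k₁ + k₂ = 4`
and all `kᵢ ≤ 2` (types `(2,1,1)`, `(2,2,0)` up to relabelling — what `χ(M) = 2` leaves outside the
Meier–Schirmer–Zupan range), `T` is reducible, OR `M` has a GK-trisection of genus `< 4`, OR `M` is a
surgery on a smoothly embedded loop in a smooth `X` with a GK-trisection of genus `< 4`.

Exactly as the companion file `…StubLoopDichotomyFromFiveAux1.lean` does for D₅ (rungs `≥ 5`), this
file PROVES that D₄ follows from its **irreducible fixed-label core** CORE₄: the same statement for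
trisections that are NOT reducible and whose weak reduction has the labels fixed (`c` compressing in
`H₀ = T 1 ∩ T 2`, `c′` in `H₁ = T 0 ∩ T 2` and `H₂ = T 0 ∩ T 1`), with conclusion "smaller
trisection of `M` ∨ loop surgery on a smaller-genus trisected `X`" — Aranda–Zupan's opening move
(§2 p. 6: fix the labels by a symmetry of the sectors; §6 p. 20: "either `T` is reducible,
completing the proof, or …").  Relabel by the transposition `(0 p)` (`IsGKTrisection.comp_perm`);
the type hypotheses, curves, discs, non-separation and (ir)reducibility are invariant
(`Literature.Barriers.SmoothPoincare4.Trisection.*_comp_perm`, `isReducible_comp_perm`, all PROVED).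

Registered helper `helper_loopDichotomyFour_of_irreducibleCore : CORE₄ → D₄` (stub-add on the crux;
lands `--supports stmt-SmoothPoincare4-17908`).  Pure logic over PROVED tree theorems; no named fact
is used or introduced.  What remains of D₄ is CORE₄ = "Aranda–Zupan Thm. 1.3, first sentence, at
genus FOUR, for homotopy 4-spheres: an irreducible weakly reducible `(4; k)`-trisection of type
`(2,1,1)`/`(2,2,0)` of a homotopy 4-sphere contains a five-chain (or destabilises)", followed by the
general-genus §5 (five-chain surgery ⇒ loop surgery on a `(3; k′)`-trisected `X′`).

## References

* R. Aranda, A. Zupan, *Manifolds with weakly reducible genus-three trisections are standard*,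
  arXiv:2503.04607 (2025): Thm. 1.3 (p. 2), §2 (p. 6), Prop. 3.9, §4, Lemma 5.4, Prop. 5.5, §6 (p. 20).
  [ArandaZupan2025]
* D. Gay, R. Kirby, *Trisecting 4-manifolds*, Geom. Topol. 20 (2016), Def. 1. [GayKirby2016]
-/

-- the registered namespace `Summit.SmoothPoincare4.SmoothPoincare4.Theorems…` repeats a component
set_option linter.dupNamespace false

noncomputable section

open scoped Manifold ContDiff Topology ContinuousMap
open Set
open Literature.Topology.FourManifolds Literature.Topology.FourManifolds.Trisection

namespace Summit.SmoothPoincare4.SmoothPoincare4.Theorems.WeakReductionReduces.LoopDichotomy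

/-- **`helper_loopDichotomyFour_of_irreducibleCore` : CORE₄ → D₄** (registered helper of crux
stmt-SmoothPoincare4-17908, line `loop_dichotomy`, stub `stub_loopDichotomyFour`).  If `T` is
reducible the first exit holds; otherwise take the weak reduction at label `p`, relabel the sectors
by the transposition `(0 p)` (`IsGKTrisection.comp_perm`), which carries `H_p` to the `H₀` of
`T ∘ (0 p)`, keeps `Σ kᵢ = 4` (`Equiv.sum_comp`) and `kᵢ ≤ 2`, keeps curves, discs and
non-separation (`Trisection.*_comp_perm`) and irreducibility (`isReducible_comp_perm`); the core's
two exits speak of `M` only. [cite: ArandaZupan2025, §2 (p. 6), §6 (p. 20), Thm. 1.3 (p. 2)]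
[cite: GayKirby2016, Def. 1] -/
theorem helper_loopDichotomyFour_of_irreducibleCore :
    (∀ (M : Type) [TopologicalSpace M] [T2Space M] [SecondCountableTopology M] [ChartedSpace (EuclideanSpace ℝ (Fin 4)) M] [IsManifold (𝓡 4) ((⊤ : ℕ∞) : WithTop ℕ∞) M], (M ≃ₕ (Metric.sphere (0 : EuclideanSpace ℝ (Fin 5)) 1)) → ∀ (k : Fin 3 → ℕ) (T : Fin 3 → Set M), Literature.Topology.FourManifolds.IsGKTrisection M 4 k T → k 0 + k 1 + k 2 = 4 → (∀ i, k i ≤ 2) → (∃ c c' : Set M, Literature.Topology.FourManifolds.Trisection.IsCurve T c ∧ Literature.Topology.FourManifolds.Trisection.IsCurve T c' ∧ Disjoint c c' ∧ Literature.Topology.FourManifolds.Trisection.IsNonSeparating T c ∧ Literature.Topology.FourManifolds.Trisection.IsNonSeparating T c' ∧ Literature.Topology.FourManifolds.Trisection.BoundsDisc T (Literature.Topology.FourManifolds.Trisection.spineHandlebody T 0) c ∧ Literature.Topology.FourManifolds.Trisection.BoundsDisc T (Literature.Topology.FourManifolds.Trisection.spineHandlebody T 1) c' ∧ Literature.Topology.FourManifolds.Trisection.BoundsDisc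 T (Literature.Topology.FourManifolds.Trisection.spineHandlebody T 2) c') → ¬ Literature.Topology.FourManifolds.Trisection.IsReducible T → (∃ (g₁ : ℕ) (k₁ : Fin 3 → ℕ) (T₁ : Fin 3 → Set M), g₁ < 4 ∧ Literature.Topology.FourManifolds.IsGKTrisection M g₁ k₁ T₁) ∨ (∃ (X : Type) (_ : TopologicalSpace X) (_ : T2Space X) (_ : SecondCountableTopology X) (_ : ChartedSpace (EuclideanSpace ℝ (Fin 4)) X) (_ : IsManifold (𝓡 4) ((⊤ : ℕ∞) : WithTop ℕ∞) X) (g' : ℕ) (k' : Fin 3 → ℕ) (T' : Fin 3 → Set X) (ℓ : (Metric.sphere (0 : EuclideanSpace ℝ (Fin 2)) 1) → X), g' < 4 ∧ Literature.Topology.FourManifolds.IsGKTrisection X g' k' T' ∧ Manifold.IsSmoothEmbedding (𝓡 1) (𝓡 4) ((⊤ : ℕ∞) : WithTop ℕ∞) ℓ ∧ Literature.Topology.FourManifolds.IsCircleSurgery (𝓡 4) (𝓡 4) X M ℓ)) → ∀ (M : Type) [TopologicalSpace M] [T2Space M] [SecondCountableTopology M] [ChartedSpace (EuclideanSpace ℝ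 (Fin 4)) M] [IsManifold (𝓡 4) ((⊤ : ℕ∞) : WithTop ℕ∞) M], (M ≃ₕ (Metric.sphere (0 : EuclideanSpace ℝ (Fin 5)) 1)) → ∀ (k : Fin 3 → ℕ) (T : Fin 3 → Set M), Literature.Topology.FourManifolds.IsGKTrisection M 4 k T → k 0 + k 1 + k 2 = 4 → (∀ i, k i ≤ 2) → Literature.Topology.FourManifolds.Trisection.IsWeaklyReducible T → Literature.Topology.FourManifolds.Trisection.IsReducible T ∨ (∃ (g₁ : ℕ) (k₁ : Fin 3 → ℕ) (T₁ : Fin 3 → Set M), g₁ < 4 ∧ Literature.Topology.FourManifolds.IsGKTrisection M g₁ k₁ T₁) ∨ (∃ (X : Type) (_ : TopologicalSpace X) (_ : T2Space X) (_ : SecondCountableTopology X) (_ : ChartedSpace (EuclideanSpace ℝ (Fin 4)) X) (_ : IsManifold (𝓡 4) ((⊤ : ℕ∞) : WithTop ℕ∞) X) (g' : ℕ) (k' : Fin 3 → ℕ) (T' : Fin 3 → Set X) (ℓ : (Metric.sphere (0 : EuclideanSpace ℝ (Fin 2)) 1) → X), g' < 4 ∧ Literature.Topology.FourManifolds.IsGKTrisection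 X g' k' T' ∧ Manifold.IsSmoothEmbedding (𝓡 1) (𝓡 4) ((⊤ : ℕ∞) : WithTop ℕ∞) ℓ ∧ Literature.Topology.FourManifolds.IsCircleSurgery (𝓡 4) (𝓡 4) X M ℓ) := by
  intro hcore M _ _ _ _ _ e k T hT hsum hk hwr
  by_cases hred : IsReducible T
  · exact Or.inl hred
  · obtain ⟨p, c, c', hc, hc', hd, hn, hn', hb, hb'⟩ := hwr
    have hσ0 : Equiv.swap (0 : Fin 3) p 0 = p := Equiv.swap_apply_left 0 p
    have hne : ∀ q : Fin 3, q ≠ 0 → Equiv.swap (0 : Fin 3) p q ≠ p := fun q hq heq =>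
      hq ((Equiv.swap (0 : Fin 3) p).injective (heq.trans hσ0.symm))
    have hT' : IsGKTrisection M 4 (k ∘ Equiv.swap (0 : Fin 3) p) (T ∘ Equiv.swap (0 : Fin 3) p) :=
      hT.comp_perm _
    have hsum' : (k ∘ Equiv.swap (0 : Fin 3) p) 0 + (k ∘ Equiv.swap (0 : Fin 3) p) 1 +
        (k ∘ Equiv.swap (0 : Fin 3) p) 2 = 4 := by
      have h := Equiv.sum_comp (Equiv.swap (0 : Fin 3) p) k
      simp only [Fin.sum_univ_three] at h
      simp only [Function.comp_apply]
      omega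
    have hk' : ∀ i, (k ∘ Equiv.swap (0 : Fin 3) p) i ≤ 2 := fun i => hk _
    have hred' : ¬ IsReducible (T ∘ Equiv.swap (0 : Fin 3) p) := fun h =>
      hred ((isReducible_comp_perm T _).1 h)
    have hwr' : ∃ c c' : Set M, IsCurve (T ∘ Equiv.swap (0 : Fin 3) p) c ∧
        IsCurve (T ∘ Equiv.swap (0 : Fin 3) p) c' ∧ Disjoint c c' ∧
        IsNonSeparating (T ∘ Equiv.swap (0 : Fin 3) p) c ∧
        IsNonSeparating (T ∘ Equiv.swap (0 : Fin 3) p) c' ∧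
        BoundsDisc (T ∘ Equiv.swap (0 : Fin 3) p)
          (spineHandlebody (T ∘ Equiv.swap (0 : Fin 3) p) 0) c ∧
        BoundsDisc (T ∘ Equiv.swap (0 : Fin 3) p)
          (spineHandlebody (T ∘ Equiv.swap (0 : Fin 3) p) 1) c' ∧
        BoundsDisc (T ∘ Equiv.swap (0 : Fin 3) p)
          (spineHandlebody (T ∘ Equiv.swap (0 : Fin 3) p) 2) c' := by
      refine ⟨c, c', (Literature.Barriers.SmoothPoincare4.Trisection.isCurve_comp_perm T _ c).2 hc,
        (Literature.Barriers.SmoothPoincare4.Trisection.isCurve_comp_perm T _ c').2 hc', hd,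
        (Literature.Barriers.SmoothPoincare4.Trisection.isNonSeparating_comp_perm T _ c).2 hn,
        (Literature.Barriers.SmoothPoincare4.Trisection.isNonSeparating_comp_perm T _ c').2 hn',
        ?_, ?_, ?_⟩
      · rw [Literature.Barriers.SmoothPoincare4.Trisection.spineHandlebody_comp_perm,
          Literature.Barriers.SmoothPoincare4.Trisection.boundsDisc_comp_perm, hσ0]
        exact hb
      · rw [Literature.Barriers.SmoothPoincare4.Trisection.spineHandlebody_comp_perm,
          Literature.Barriers.SmoothPoincare4.Trisection.boundsDisc_comp_perm]
        exact hb' _ (hne 1 (by decide))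
      · rw [Literature.Barriers.SmoothPoincare4.Trisection.spineHandlebody_comp_perm,
          Literature.Barriers.SmoothPoincare4.Trisection.boundsDisc_comp_perm]
        exact hb' _ (hne 2 (by decide))
    rcases hcore M e _ _ hT' hsum' hk' hwr' hred' with h2 | h3
    · exact Or.inr (Or.inl h2)
    · exact Or.inr (Or.inr h3)

end Summit.SmoothPoincare4.SmoothPoincare4.Theorems.WeakReductionReduces.LoopDichotomy

end
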